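import Summits.BirchSwinnertonDyer.BirchSwinnertonDyer.Theorems.EisensteinPrimesLineCharactersUnramifiedAtMultiplicativePlace
import Literature.NumberTheory.EllipticCurves.OpenImageMazurFrobeniusNumberFieldProofs
import Literature.NumberTheory.GaloisRepresentations.IntegralGaloisActionProofs
import HarnessLib

/-!
# Crux 3 `MazurMCOnCellB` (stmt-BirchSwinnertonDyer-19033), line `twistback` v12 — lane ISO-3:
# GREENBERG–VATSAL PROP. (2.4) AT A GOOD PLACE: `δ_E^{(v)} = s_ℓ·([φ(ℓ) = ℓ̄] + [ψ(ℓ) = ℓ̄])`, i.e. the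
# sub-row datum's local term EQUALS `δ` at every good `v ∤ p` — good places are idle in `S₀`

Width seat bsd-line-x2-p1-w7 (gen 4), cell `bsd-eis` (run/shared/lean/pub/bsd-eis/), 2026-08-29. Sequel of this lineage's
`…LineCharactersWeilRelation` (w7 g0), `…LocalBalanceAtMultiplicativePlace` (w7 g0), `…LocalBalanceAtUnramifiedPlace`
(w7 g2) and `…TwistbackSubrowDatumIsogeny` (w7 g4, p681078). HONEST FRAMING: TOOL THEOREMS ONLY (no `def`, no named
fact, no `sorry`); every input a tree THEOREM; `--supports` stmt-BirchSwinnertonDyer-19033; closes no stub; no summit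
statement, no Mazur main conjecture, no BSD is proved for any curve; 0 cells / labels / stubs / tiers move.

WHY. The registered stub `stub_offSubrow_connectedShaUnitOrPartner` (v12) is asked OFF the sub-row datum «`p = 3`,
`3` non-split, a rational `3`-line `Φ₀` with primitive presentations `(m, φ)` / `(d, ψ)`, a finite `S₀ ∌ (3)` off which
`E` is good, and `1 + Σ_{v ∈ S₀} δ_E^{(v)} = Σ_{v ∈ S₀} (s_v·[φ(ℓ_v) = ℓ̄_v] + s_v·[ψ(ℓ_v) = ℓ̄_v])`». The datum lets
`S₀` contain GOOD places. The desk of the sub-row (w3 g10 `…SubrowReducedBalance`, w7 g0/g2, w3 g10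
`…LineCharactersUnramifiedAtMultiplicativePlace`) evaluates the summand at every MULTIPLICATIVE and every ADDITIVE place;
the GOOD places were never evaluated, because every per-cell display takes `S₀ = {bad places ≠ 3}`. Greenberg–Vatsal
Prop. (2.4) says what happens there: for a good `ℓ ≠ p`, `P̃_ℓ(X) = (1 − φ(ℓ)X)(1 − ψ(ℓ)X)` in `𝔽_p[X]` (the
semisimplification of `E[p]` is `φ ⊕ ψ`), so `d_ℓ = [φ(ℓ) = ℓ̄] + [ψ(ℓ) = ℓ̄]` and the summand of the sub-row identity
at `v = (ℓ)` IS `δ_E^{(v)}` — good places contribute equally to both sides. Consequences: the datum's `S₀` may be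
shrunk to the bad places (canonical form) or padded by good places at will; this is the prerequisite for moving the
datum along admissible quadratic twists (where `S₀` grows by the — good for `E` — primes of the discriminants).

* §1 `apply_sub_eq_one_of_mem_inertia_of_good` / `apply_quot_eq_one_of_mem_inertia_of_good` — at a good `v ∤ p`
  both presenting characters are trivial on inertia (Silverman VII.4.1 (a), tree
  `smul_eq_of_mem_inertia_of_nsmul_eq_zero`; the quotient via the Weil relation and `χ_p(I_𝔓) = 1`);
  §2 `not_dvd_level_sub_of_good` / `not_dvd_level_quot_of_good` — hence `ℓ ∤ m`, `ℓ ∤ d` for PRIMITIVE presentations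
  (`PrimeOrderCharacters.not_dvd_level_of_isPrimitive_of_forall_mem_inertia`).
* §3 **`frobeniusTraceAt_eq_apply_add_apply`** — `a_v ≡ φ(ℓ) + ψ(ℓ) (mod p)` and `φ(ℓ)ψ(ℓ) = ℓ̄`: Mazur 1978
  Prop. 6.3 (1) in the tree (`isogenyCharacter_sq_sub_frobeniusTraceAt_mul_add_eq_zero`: `r(σ)² − a_v r(σ) + q_v = 0`
  for the line character `r` at an arithmetic Frobenius `σ`), `χ_N(σ) = ℓ` (`modNCyclotomicCharacter_eq_residueCard_of_isArithFrobAt`)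
  and the Weil relation `φ(χ_m σ)ψ(χ_d σ) = χ_p(σ)` (`apply_mul_apply_eq_modNCyclotomicCharacter`).
* §4 **`dMultiplicity_eq_of_good`**, **`delta_eq_term_of_good`** — GV Prop. (2.4) at a good place:
  `δ_E^{(v)} = (if φ(ℓ) = ℓ̄ then s_ℓ else 0) + (if ψ(ℓ) = ℓ̄ then s_ℓ else 0)`, EXACTLY the summand of the registered datum
  (root multiplicities of `(1 − φ(ℓ)X)(1 − ψ(ℓ)X)` at `ℓ̄⁻¹`, as in `X2.LocalDeltaCalculus`).
* §5 **`balance_iff_sdiff_of_good`** — in the datum's identity the good places of `S₀` cancel: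
  `n + Σ_{S₀} δ = Σ_{S₀} term ↔ n + Σ_{S₀ ∖ T} δ = Σ_{S₀ ∖ T} term` for any `T ⊆ S₀` of good places.

References: [GreenbergVatsal2000] §2 Prop. (2.4) p. 22 (`d_ℓ` = multiplicity of `ℓ̃⁻¹` as a root of `P̃_ℓ`), p. 27
(worked example `52A1`, `p = 5`, `ℓ = 7`: `1 + 2X + 7X² ≡ (1 − X)(1 − 2X)`), p. 28 (`φψ = ω`); [Mazur1978] §6
Prop. 6.3 (1); [SilvermanAEC2009] VII.4.1 (a), V.2.3.1 (b), C.§16; [Washington1997] Ch. 3 (conductors).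
-/

set_option autoImplicit false

-- `Summit.BirchSwinnertonDyer.BirchSwinnertonDyer.…`: the summit and its single sub-problem share a name.
set_option linter.dupNamespace false

noncomputable section

open scoped Classical

open NumberField IsDedekindDomain Field WeierstrassCurve Polynomial
  Literature.NumberTheory.EllipticCurves Literature.NumberTheory.GaloisRepresentations
  Literature.NumberTheory.EllipticCurves.GreenbergVatsal2000
  Literature.NumberTheory.EllipticCurves.Rank1Residual
  Literature.NumberTheory.EllipticCurves.Mazur1978
  Summit.BirchSwinnertonDyer.Rank1Residual.X2
  Summit.BirchSwinnertonDyer.Rank1Residual.X2.PrimeOrderCharacters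
  Summit.BirchSwinnertonDyer.Rank1Residual.X2.LocalDeltaCalculus
  Summit.BirchSwinnertonDyer.BirchSwinnertonDyer.Theorems.EisensteinPrimesLineCharactersWeilRelation
  Summit.BirchSwinnertonDyer.BirchSwinnertonDyer.Theorems.EisensteinPrimesLineCharactersAtMultiplicativePlace
  Summit.BirchSwinnertonDyer.BirchSwinnertonDyer.Theorems.EisensteinPrimesLineCharactersUnramifiedAtMultiplicativePlace

namespace Summit.BirchSwinnertonDyer.BirchSwinnertonDyer.Theorems.EisensteinPrimesLocalBalanceAtGoodPlace

variable {W : WeierstrassCurve ℚ} [W.IsElliptic] {p : ℕ} [hp : Fact p.Prime]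
  {Φ₀ : AddSubgroup (geomTorsion W (p : ℤ))}
  {m : ℕ} [NeZero m] {φ : DirichletCharacter (ZMod p) m} {d : ℕ} [NeZero d] {ψ : DirichletCharacter (ZMod p) d}

/-! ## §1. At a good place `v ∤ p` both presenting characters are trivial on inertia -/

omit [W.IsElliptic] in
/-- A non-zero point of a rational line, with the line character as a hom `Γ_ℚ → 𝔽_pˣ` acting on it. [folklore] -/
theorem exists_ne_zero_smul_eq (hΦ : IsRationalLine W p Φ₀)
    (hφ0 : ∀ (σ : absoluteGaloisGroup ℚ), ∀ P ∈ Φ₀,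
      σ • P = (φ ((modNCyclotomicCharacter ℚ m σ : (ZMod m)ˣ) : ZMod m)).val • P) :
    ∃ P : geomTorsion W (p : ℤ), P ≠ 0 ∧ ∀ σ : absoluteGaloisGroup ℚ,
      σ • P = ((φ.toUnitHom.comp (modNCyclotomicCharacter ℚ m) σ : (ZMod p)ˣ) : ZMod p).val • P := by
  haveI : Finite Φ₀ := Nat.finite_of_card_ne_zero (by rw [hΦ.1]; exact hp.out.ne_zero)
  haveI : Nontrivial Φ₀ := Finite.one_lt_card_iff_nontrivial.mp (by rw [hΦ.1]; exact hp.out.one_lt)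
  obtain ⟨⟨P, hPΦ⟩, hP⟩ := exists_ne (0 : Φ₀)
  exact ⟨P, fun h ↦ hP (Subtype.ext h), fun σ ↦ by rw [coe_toUnitHom_comp]; exact hφ0 σ P hPΦ⟩

/-- **`φ(χ_m τ) = 1` on inertia at a GOOD place `v ∤ p`.** For a rational `p`-line `Φ₀ ≤ E[p]` on which `Γ_ℚ` acts
through `φ` mod `m`, a place `v ∤ p` of GOOD reduction, a prime `𝔓` of `ℤ̄` above `v` and `τ ∈ I_𝔓`: `φ(χ_m(τ)) = 1`
— `I_𝔓` fixes `E[p]` (Silverman VII.4.1 (a); tree `isogenyCharacter_eq_one_of_mem_inertia_of_hasGoodReductionAt`).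
[cite: SilvermanAEC2009, Prop. VII.4.1(a)] -/
theorem apply_sub_eq_one_of_mem_inertia_of_good {v : HeightOneSpectrum (𝓞 ℚ)}
    (hgood : W.HasGoodReductionAt v) (hpv : ((p : ℕ) : 𝓞 ℚ) ∉ v.asIdeal)
    {𝔓 : Ideal (absIntegers (𝓞 ℚ) ℚ)} (h𝔓 : 𝔓 ∈ v.primesAbove)
    {τ : absoluteGaloisGroup ℚ} (hτ : τ ∈ 𝔓.inertia (absoluteGaloisGroup ℚ))
    (hΦ : IsRationalLine W p Φ₀)
    (hφ0 : ∀ (σ : absoluteGaloisGroup ℚ), ∀ P ∈ Φ₀,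
      σ • P = (φ ((modNCyclotomicCharacter ℚ m σ : (ZMod m)ˣ) : ZMod m)).val • P) :
    φ ((modNCyclotomicCharacter ℚ m τ : (ZMod m)ˣ) : ZMod m) = 1 := by
  obtain ⟨P, hP0, hr⟩ := exists_ne_zero_smul_eq hΦ hφ0
  have h := isogenyCharacter_eq_one_of_mem_inertia_of_hasGoodReductionAt W p hP0 hr hgood hpv h𝔓 hτ
  rw [← coe_toUnitHom_comp, h, Units.val_one]

/-- **`ψ(χ_d τ) = 1` on inertia at a GOOD place `v ∤ p`** (quotient character): by §1.2 for `φ`, the Weil relation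
`φ(χ_m τ)·ψ(χ_d τ) = χ_p(τ)` and `χ_p(I_𝔓) = 1` for `𝔓 ∤ p`. [cite: GreenbergVatsal2000, §2 p. 28 (φψ = ω)]
[cite: SilvermanAEC2009, Prop. VII.4.1(a)] -/
theorem apply_quot_eq_one_of_mem_inertia_of_good {v : HeightOneSpectrum (𝓞 ℚ)}
    (hgood : W.HasGoodReductionAt v) (hpv : ((p : ℕ) : 𝓞 ℚ) ∉ v.asIdeal)
    {𝔓 : Ideal (absIntegers (𝓞 ℚ) ℚ)} (h𝔓 : 𝔓 ∈ v.primesAbove)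
    {τ : absoluteGaloisGroup ℚ} (hτ : τ ∈ 𝔓.inertia (absoluteGaloisGroup ℚ))
    (hΦ : IsRationalLine W p Φ₀)
    (hφ0 : ∀ (σ : absoluteGaloisGroup ℚ), ∀ P ∈ Φ₀,
      σ • P = (φ ((modNCyclotomicCharacter ℚ m σ : (ZMod m)ˣ) : ZMod m)).val • P)
    (hψ0 : ∀ (σ : absoluteGaloisGroup ℚ) (Q : geomTorsion W (p : ℤ)),
      σ • Q - (ψ ((modNCyclotomicCharacter ℚ d σ : (ZMod d)ˣ) : ZMod d)).val • Q ∈ Φ₀) :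
    ψ ((modNCyclotomicCharacter ℚ d τ : (ZMod d)ˣ) : ZMod d) = 1 := by
  haveI := h𝔓.1
  have hN : ((p : ℕ) : absIntegers (𝓞 ℚ) ℚ) ∉ 𝔓 :=
    Rat.natCast_not_mem_of_mem_primesAbove_of_not_dvd h𝔓 (not_natGenerator_dvd hpv)
  have hW := apply_mul_apply_eq_modNCyclotomicCharacter hΦ φ ψ hφ0 hψ0 τ
  rw [apply_sub_eq_one_of_mem_inertia_of_good hgood hpv h𝔓 hτ hΦ hφ0, one_mul,
    modNCyclotomicCharacter_eq_one_of_mem_inertia hN hτ, Units.val_one] at hW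
  exact hW

/-! ## §2. The levels of PRIMITIVE presentations are prime to every good `ℓ ≠ p` -/

/-- **`ℓ ∤ m` at a good place**: the conductor of the (primitive) character of a rational `p`-line is prime to every
prime `ℓ ≠ p` of GOOD reduction (§1 + the conductor criterion). [cite: Washington1997, Ch. 3 (conductor and ramification)]
[cite: SilvermanAEC2009, Prop. VII.4.1(a)] -/
theorem not_dvd_level_sub_of_good {v : HeightOneSpectrum (𝓞 ℚ)}
    (hgood : W.HasGoodReductionAt v) (hpv : ((p : ℕ) : 𝓞 ℚ) ∉ v.asIdeal)
    (hΦ : IsRationalLine W p Φ₀) (hφ : φ.IsPrimitive)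
    (hφ0 : ∀ (σ : absoluteGaloisGroup ℚ), ∀ P ∈ Φ₀,
      σ • P = (φ ((modNCyclotomicCharacter ℚ m σ : (ZMod m)ˣ) : ZMod m)).val • P) :
    ¬ Rat.HeightOneSpectrum.natGenerator v ∣ m :=
  not_dvd_level_of_isPrimitive_of_forall_mem_inertia hφ (Rat.HeightOneSpectrum.prime_natGenerator v)
    (natCast_mem_asIdeal_of_primesEquiv_eq (coe_primesEquiv_eq_natGenerator v))
    (adicCompletionPrime_mem_primesAbove ℚ v)
    fun _ hτ ↦ apply_sub_eq_one_of_mem_inertia_of_good hgood hpv (adicCompletionPrime_mem_primesAbove ℚ v) hτ hΦ hφ0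

/-- **`ℓ ∤ d` at a good place**: the conductor of the (primitive) quotient character of a rational `p`-line is prime
to every prime `ℓ ≠ p` of GOOD reduction. [cite: Washington1997, Ch. 3 (conductor and ramification)]
[cite: GreenbergVatsal2000, §2 p. 28 (φψ = ω)] -/
theorem not_dvd_level_quot_of_good {v : HeightOneSpectrum (𝓞 ℚ)}
    (hgood : W.HasGoodReductionAt v) (hpv : ((p : ℕ) : 𝓞 ℚ) ∉ v.asIdeal)
    (hΦ : IsRationalLine W p Φ₀) (hψ : ψ.IsPrimitive)
    (hφ0 : ∀ (σ : absoluteGaloisGroup ℚ), ∀ P ∈ Φ₀,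
      σ • P = (φ ((modNCyclotomicCharacter ℚ m σ : (ZMod m)ˣ) : ZMod m)).val • P)
    (hψ0 : ∀ (σ : absoluteGaloisGroup ℚ) (Q : geomTorsion W (p : ℤ)),
      σ • Q - (ψ ((modNCyclotomicCharacter ℚ d σ : (ZMod d)ˣ) : ZMod d)).val • Q ∈ Φ₀) :
    ¬ Rat.HeightOneSpectrum.natGenerator v ∣ d :=
  not_dvd_level_of_isPrimitive_of_forall_mem_inertia hψ (Rat.HeightOneSpectrum.prime_natGenerator v)
    (natCast_mem_asIdeal_of_primesEquiv_eq (coe_primesEquiv_eq_natGenerator v))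
    (adicCompletionPrime_mem_primesAbove ℚ v)
    fun _ hτ ↦ apply_quot_eq_one_of_mem_inertia_of_good hgood hpv (adicCompletionPrime_mem_primesAbove ℚ v) hτ hΦ
      hφ0 hψ0

/-! ## §3. `a_v ≡ φ(ℓ) + ψ(ℓ) (mod p)` and `φ(ℓ)ψ(ℓ) = ℓ̄` at a good place `v = (ℓ) ∤ p` -/

/-- **The values at `ℓ` of both presentations and of `χ_p` at an arithmetic Frobenius above a good `v = (ℓ)`,
`ℓ ∤ p m d`**: `φ(χ_m σ) = φ(ℓ)`, `ψ(χ_d σ) = ψ(ℓ)`, `χ_p(σ) = ℓ̄` (`χ_N(Frob_ℓ) = ℓ`, Neukirch I (10.3)).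
[cite: NeukirchANT1999, Ch. I §10 (10.3)] -/
theorem apply_frob_eq {v : HeightOneSpectrum (𝓞 ℚ)} (hpv : ((p : ℕ) : 𝓞 ℚ) ∉ v.asIdeal)
    (hℓm : ¬ Rat.HeightOneSpectrum.natGenerator v ∣ m) (hℓd : ¬ Rat.HeightOneSpectrum.natGenerator v ∣ d)
    {𝔓 : Ideal (absIntegers (𝓞 ℚ) ℚ)} (h𝔓 : 𝔓 ∈ v.primesAbove)
    {σ : absoluteGaloisGroup ℚ} (hσ : IsArithFrobAt (𝓞 ℚ) σ 𝔓) :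
    ((modNCyclotomicCharacter ℚ m σ : (ZMod m)ˣ) : ZMod m) = (Rat.HeightOneSpectrum.natGenerator v : ZMod m) ∧
      ((modNCyclotomicCharacter ℚ d σ : (ZMod d)ˣ) : ZMod d) = (Rat.HeightOneSpectrum.natGenerator v : ZMod d) ∧
      ((modNCyclotomicCharacter ℚ p σ : (ZMod p)ˣ) : ZMod p) = (Rat.HeightOneSpectrum.natGenerator v : ZMod p) := by
  have hres : v.residueCard = Rat.HeightOneSpectrum.natGenerator v := by
    rw [← WeierstrassCurve.natCard_residueField_eq_residueCard, natCard_residueField_eq_natGenerator]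
  have hm : ((m : ℕ) : absIntegers (𝓞 ℚ) ℚ) ∉ 𝔓 := Rat.natCast_not_mem_of_mem_primesAbove_of_not_dvd h𝔓 hℓm
  have hd : ((d : ℕ) : absIntegers (𝓞 ℚ) ℚ) ∉ 𝔓 := Rat.natCast_not_mem_of_mem_primesAbove_of_not_dvd h𝔓 hℓd
  have hpp : ((p : ℕ) : absIntegers (𝓞 ℚ) ℚ) ∉ 𝔓 :=
    Rat.natCast_not_mem_of_mem_primesAbove_of_not_dvd h𝔓 (not_natGenerator_dvd hpv)
  refine ⟨?_, ?_, ?_⟩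
  · rw [modNCyclotomicCharacter_eq_residueCard_of_isArithFrobAt h𝔓 hm hσ, hres]
  · rw [modNCyclotomicCharacter_eq_residueCard_of_isArithFrobAt h𝔓 hd hσ, hres]
  · rw [modNCyclotomicCharacter_eq_residueCard_of_isArithFrobAt h𝔓 hpp hσ, hres]

/-- **The Weil relation at a good `ℓ ∤ p m d`: `φ(ℓ)·ψ(ℓ) = ℓ̄` in `𝔽_p`** (the Galois-level relation read at an
arithmetic Frobenius above `ℓ`). [cite: GreenbergVatsal2000, §2 p. 28 (φψ = ω)] -/
theorem apply_mul_apply_eq_natGenerator {v : HeightOneSpectrum (𝓞 ℚ)} (hpv : ((p : ℕ) : 𝓞 ℚ) ∉ v.asIdeal)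
    (hℓm : ¬ Rat.HeightOneSpectrum.natGenerator v ∣ m) (hℓd : ¬ Rat.HeightOneSpectrum.natGenerator v ∣ d)
    (hΦ : IsRationalLine W p Φ₀)
    (hφ0 : ∀ (σ : absoluteGaloisGroup ℚ), ∀ P ∈ Φ₀,
      σ • P = (φ ((modNCyclotomicCharacter ℚ m σ : (ZMod m)ˣ) : ZMod m)).val • P)
    (hψ0 : ∀ (σ : absoluteGaloisGroup ℚ) (Q : geomTorsion W (p : ℤ)),
      σ • Q - (ψ ((modNCyclotomicCharacter ℚ d σ : (ZMod d)ˣ) : ZMod d)).val • Q ∈ Φ₀) :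
    φ (Rat.HeightOneSpectrum.natGenerator v : ZMod m) * ψ (Rat.HeightOneSpectrum.natGenerator v : ZMod d) =
      (Rat.HeightOneSpectrum.natGenerator v : ZMod p) := by
  obtain ⟨σ, hσ⟩ := HeightOneSpectrum.exists_isArithFrobAt_of_mem_primesAbove_holds
    (adicCompletionPrime_mem_primesAbove ℚ v)
  obtain ⟨hm, hd, hpp⟩ := apply_frob_eq hpv hℓm hℓd (adicCompletionPrime_mem_primesAbove ℚ v) hσ
  have hW := apply_mul_apply_eq_modNCyclotomicCharacter hΦ φ ψ hφ0 hψ0 σ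
  rwa [hm, hd, hpp] at hW

/-- **`a_v ≡ φ(ℓ) + ψ(ℓ) (mod p)` at a good place `v = (ℓ)`, `ℓ ∤ p m d`** — the trace of Frobenius on `E[p]` is the
sum of the two constituents of its semisimplification. In the tree: Mazur 1978 Prop. 6.3 (1)
(`isogenyCharacter_sq_sub_frobeniusTraceAt_mul_add_eq_zero`: the line character `r = φ ∘ χ_m` satisfies
`r(σ)² − a_v r(σ) + q_v = 0` at an arithmetic Frobenius `σ` above `v`) with `r(σ) = φ(ℓ)`, `q_v = ℓ = φ(ℓ)ψ(ℓ)` (§3.2)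
and `φ(ℓ) ≠ 0`. [cite: Mazur1978, §6 Prop. 6.3 (1) and its proof (p. 153)] [cite: GreenbergVatsal2000, §2 Prop. (2.4) (p. 22)] -/
theorem frobeniusTraceAt_eq_apply_add_apply {v : HeightOneSpectrum (𝓞 ℚ)}
    (hgood : W.HasGoodReductionAt v) (hpv : ((p : ℕ) : 𝓞 ℚ) ∉ v.asIdeal)
    (hℓm : ¬ Rat.HeightOneSpectrum.natGenerator v ∣ m) (hℓd : ¬ Rat.HeightOneSpectrum.natGenerator v ∣ d)
    (hΦ : IsRationalLine W p Φ₀)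
    (hφ0 : ∀ (σ : absoluteGaloisGroup ℚ), ∀ P ∈ Φ₀,
      σ • P = (φ ((modNCyclotomicCharacter ℚ m σ : (ZMod m)ˣ) : ZMod m)).val • P)
    (hψ0 : ∀ (σ : absoluteGaloisGroup ℚ) (Q : geomTorsion W (p : ℤ)),
      σ • Q - (ψ ((modNCyclotomicCharacter ℚ d σ : (ZMod d)ˣ) : ZMod d)).val • Q ∈ Φ₀) :
    ((W.frobeniusTraceAt v : ℤ) : ZMod p) =
      φ (Rat.HeightOneSpectrum.natGenerator v : ZMod m) + ψ (Rat.HeightOneSpectrum.natGenerator v : ZMod d) := by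
  obtain ⟨P, hP0, hr⟩ := exists_ne_zero_smul_eq hΦ hφ0
  obtain ⟨σ, hσ⟩ := HeightOneSpectrum.exists_isArithFrobAt_of_mem_primesAbove_holds
    (adicCompletionPrime_mem_primesAbove ℚ v)
  obtain ⟨hm, -, -⟩ := apply_frob_eq hpv hℓm hℓd (adicCompletionPrime_mem_primesAbove ℚ v) hσ
  -- Mazur Prop. 6.3 (1): `r(σ)² − a_v r(σ) + q_v = 0`
  have hM := isogenyCharacter_sq_sub_frobeniusTraceAt_mul_add_eq_zero W p hgood hpv hP0 hr
    (adicCompletionPrime_mem_primesAbove ℚ v) hσ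
  rw [coe_toUnitHom_comp, hm, natCard_residueField_eq_natGenerator,
    ← apply_mul_apply_eq_natGenerator hpv hℓm hℓd hΦ hφ0 hψ0] at hM
  -- `φ(ℓ)·(φ(ℓ) − a_v + ψ(ℓ)) = 0` with `φ(ℓ)` a unit
  set α : ZMod p := φ (Rat.HeightOneSpectrum.natGenerator v : ZMod m) with hα
  set β : ZMod p := ψ (Rat.HeightOneSpectrum.natGenerator v : ZMod d) with hβ
  have hα0 : α ≠ 0 := by
    rw [hα, ← hm, ← coe_toUnitHom_comp]
    exact Units.ne_zero _
  have hfac : α * (α + β - ((W.frobeniusTraceAt v : ℤ) : ZMod p)) = 0 := by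
    linear_combination hM
  rcases mul_eq_zero.mp hfac with h | h
  · exact absurd h hα0
  · exact (sub_eq_zero.mp h).symm

/-! ## §4. Greenberg–Vatsal Prop. (2.4) at a good place: `d_ℓ = [φ(ℓ) = ℓ̄] + [ψ(ℓ) = ℓ̄]`, `δ = the summand` -/

/-- **`P̃_ℓ = (1 − φ(ℓ)X)(1 − ψ(ℓ)X)` at a good `ℓ ∤ p m d`** (Greenberg–Vatsal Prop. (2.4): "`d_ℓ` denotes the
multiplicity of `X = ℓ̃⁻¹` as a root of `P̃_ℓ(X) ∈ k[X]`", with `P̃_ℓ = 1 − ã X + ℓ̃ X²`, `ã = φ(ℓ) + ψ(ℓ)`,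
`ℓ̃ = φ(ℓ)ψ(ℓ)`). [cite: GreenbergVatsal2000, §2 Prop. (2.4) (p. 22) and p. 27] -/
theorem eulerFactorModP_eq_mul_of_good {v : HeightOneSpectrum (𝓞 ℚ)}
    (hgood : W.HasGoodReductionAt v) (hpv : ((p : ℕ) : 𝓞 ℚ) ∉ v.asIdeal)
    (hℓm : ¬ Rat.HeightOneSpectrum.natGenerator v ∣ m) (hℓd : ¬ Rat.HeightOneSpectrum.natGenerator v ∣ d)
    (hΦ : IsRationalLine W p Φ₀)
    (hφ0 : ∀ (σ : absoluteGaloisGroup ℚ), ∀ P ∈ Φ₀,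
      σ • P = (φ ((modNCyclotomicCharacter ℚ m σ : (ZMod m)ˣ) : ZMod m)).val • P)
    (hψ0 : ∀ (σ : absoluteGaloisGroup ℚ) (Q : geomTorsion W (p : ℤ)),
      σ • Q - (ψ ((modNCyclotomicCharacter ℚ d σ : (ZMod d)ˣ) : ZMod d)).val • Q ∈ Φ₀) :
    eulerFactorModP W p v =
      (1 - C (φ (Rat.HeightOneSpectrum.natGenerator v : ZMod m)) * X) *
        (1 - C (ψ (Rat.HeightOneSpectrum.natGenerator v : ZMod d)) * X) := by
  rw [eulerFactorModP_of_hasGoodReductionAt hgood, frobeniusTraceAt_eq_apply_add_apply hgood hpv hℓm hℓd hΦ hφ0 hψ0,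
    ← apply_mul_apply_eq_natGenerator hpv hℓm hℓd hΦ hφ0 hψ0]
  simp only [map_add, map_mul]
  ring

/-- Root multiplicity of `1 − αX` at `x`, `α ≠ 0`: `[x = α⁻¹]`. [folklore] -/
theorem rootMultiplicity_one_sub_C_mul_X {α : ZMod p} (hα : α ≠ 0) (x : ZMod p) :
    (1 - C α * X : (ZMod p)[X]).rootMultiplicity x = if α = x⁻¹ then 1 else 0 := by
  have hfac : (1 - C α * X : (ZMod p)[X]) = C (-α) * (X - C α⁻¹) := by
    have key : (C α * C α⁻¹ : (ZMod p)[X]) = 1 := by rw [← C_mul, mul_inv_cancel₀ hα, C_1]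
    simp only [map_neg]
    linear_combination (-1 : (ZMod p)[X]) * key
  have hne : (C (-α) : (ZMod p)[X]) ≠ 0 := by rw [Ne, C_eq_zero, neg_eq_zero]; exact hα
  rw [hfac, rootMultiplicity_mul (mul_ne_zero hne (X_sub_C_ne_zero _)), rootMultiplicity_C, zero_add,
    rootMultiplicity_X_sub_C]
  by_cases h : α = x⁻¹
  · rw [if_pos h, if_pos (by rw [h, inv_inv])]
  · rw [if_neg h, if_neg (by intro hx; exact h (by rw [hx, inv_inv]))]

/-- **Greenberg–Vatsal Prop. (2.4) at a GOOD place: `d_ℓ = [φ(ℓ) = ℓ̄] + [ψ(ℓ) = ℓ̄]`** for a rational `p`-line with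
presentations `(m, φ)` / `(d, ψ)` and a good `v = (ℓ)`, `ℓ ∤ p m d`. [cite: GreenbergVatsal2000, §2 Prop. (2.4) (p. 22) and p. 27] -/
theorem dMultiplicity_eq_of_good {v : HeightOneSpectrum (𝓞 ℚ)}
    (hgood : W.HasGoodReductionAt v) (hpv : ((p : ℕ) : 𝓞 ℚ) ∉ v.asIdeal)
    (hℓm : ¬ Rat.HeightOneSpectrum.natGenerator v ∣ m) (hℓd : ¬ Rat.HeightOneSpectrum.natGenerator v ∣ d)
    (hΦ : IsRationalLine W p Φ₀)
    (hφ0 : ∀ (σ : absoluteGaloisGroup ℚ), ∀ P ∈ Φ₀,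
      σ • P = (φ ((modNCyclotomicCharacter ℚ m σ : (ZMod m)ˣ) : ZMod m)).val • P)
    (hψ0 : ∀ (σ : absoluteGaloisGroup ℚ) (Q : geomTorsion W (p : ℤ)),
      σ • Q - (ψ ((modNCyclotomicCharacter ℚ d σ : (ZMod d)ˣ) : ZMod d)).val • Q ∈ Φ₀) :
    dMultiplicity W p v =
      (if φ (Rat.HeightOneSpectrum.natGenerator v : ZMod m) = (Rat.HeightOneSpectrum.natGenerator v : ZMod p)
        then 1 else 0) +
      (if ψ (Rat.HeightOneSpectrum.natGenerator v : ZMod d) = (Rat.HeightOneSpectrum.natGenerator v : ZMod p)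
        then 1 else 0) := by
  set α : ZMod p := φ (Rat.HeightOneSpectrum.natGenerator v : ZMod m) with hα
  set β : ZMod p := ψ (Rat.HeightOneSpectrum.natGenerator v : ZMod d) with hβ
  set l : ZMod p := (Rat.HeightOneSpectrum.natGenerator v : ZMod p) with hl
  have hℓp : Rat.HeightOneSpectrum.natGenerator v ≠ p := fun h ↦
    hpv (h ▸ natCast_mem_asIdeal_of_primesEquiv_eq (coe_primesEquiv_eq_natGenerator v))
  have hl0 : l ≠ 0 := natGenerator_cast_ne_zero hℓp
  have hαβ : α * β = l := apply_mul_apply_eq_natGenerator hpv hℓm hℓd hΦ hφ0 hψ0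
  have hα0 : α ≠ 0 := fun h ↦ hl0 (by rw [← hαβ, h, zero_mul])
  have hβ0 : β ≠ 0 := fun h ↦ hl0 (by rw [← hαβ, h, mul_zero])
  have hne1 : (1 - C α * X : (ZMod p)[X]) ≠ 0 := by
    intro h
    have h0 := congrArg (fun P : (ZMod p)[X] ↦ P.coeff 0) h
    simp at h0
  have hne2 : (1 - C β * X : (ZMod p)[X]) ≠ 0 := by
    intro h
    have h0 := congrArg (fun P : (ZMod p)[X] ↦ P.coeff 0) h
    simp at h0
  unfold dMultiplicity
  rw [eulerFactorModP_eq_mul_of_good hgood hpv hℓm hℓd hΦ hφ0 hψ0, rootMultiplicity_mul (mul_ne_zero hne1 hne2),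
    rootMultiplicity_one_sub_C_mul_X hα0, rootMultiplicity_one_sub_C_mul_X hβ0]
  -- the root is `x = ℓ̄⁻¹`, and `α = x⁻¹` reads `α = ℓ̄`
  simp only [inv_inv, hl]

/-- **`δ_E^{(v)}` IS the summand of the sub-row identity at a GOOD place** `v = (ℓ) ∤ p`, `ℓ ∤ m d`:
`δ_E^{(v)} = (if φ(ℓ) = ℓ̄ then s_ℓ else 0) + (if ψ(ℓ) = ℓ̄ then s_ℓ else 0)` (`δ = s_ℓ · d_ℓ`, §4.3).
[cite: GreenbergVatsal2000, §2 Prop. (2.4) (p. 22)] -/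
theorem delta_eq_term_of_good {v : HeightOneSpectrum (𝓞 ℚ)}
    (hgood : W.HasGoodReductionAt v) (hpv : ((p : ℕ) : 𝓞 ℚ) ∉ v.asIdeal)
    (hℓm : ¬ Rat.HeightOneSpectrum.natGenerator v ∣ m) (hℓd : ¬ Rat.HeightOneSpectrum.natGenerator v ∣ d)
    (hΦ : IsRationalLine W p Φ₀)
    (hφ0 : ∀ (σ : absoluteGaloisGroup ℚ), ∀ P ∈ Φ₀,
      σ • P = (φ ((modNCyclotomicCharacter ℚ m σ : (ZMod m)ˣ) : ZMod m)).val • P)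
    (hψ0 : ∀ (σ : absoluteGaloisGroup ℚ) (Q : geomTorsion W (p : ℤ)),
      σ • Q - (ψ ((modNCyclotomicCharacter ℚ d σ : (ZMod d)ˣ) : ZMod d)).val • Q ∈ Φ₀) :
    delta W p v =
      (if φ (Rat.HeightOneSpectrum.natGenerator v : ZMod m) = (Rat.HeightOneSpectrum.natGenerator v : ZMod p)
        then sFactor p (Rat.HeightOneSpectrum.natGenerator v) else 0) +
      (if ψ (Rat.HeightOneSpectrum.natGenerator v : ZMod d) = (Rat.HeightOneSpectrum.natGenerator v : ZMod p)
        then sFactor p (Rat.HeightOneSpectrum.natGenerator v) else 0) := by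
  rw [delta_eq, dMultiplicity_eq_of_good hgood hpv hℓm hℓd hΦ hφ0 hψ0]
  split_ifs <;> ring

/-- **The same for PRIMITIVE presentations, side conditions discharged** (`ℓ ∤ m`, `ℓ ∤ d` by §2): at every good
place `v ∤ p`, `δ_E^{(v)}` equals the summand of the registered sub-row identity. [cite: GreenbergVatsal2000, §2 Prop. (2.4) (p. 22)] -/
theorem delta_eq_term_of_good_of_isPrimitive {v : HeightOneSpectrum (𝓞 ℚ)}
    (hgood : W.HasGoodReductionAt v) (hpv : ((p : ℕ) : 𝓞 ℚ) ∉ v.asIdeal)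
    (hΦ : IsRationalLine W p Φ₀) (hφ : φ.IsPrimitive) (hψ : ψ.IsPrimitive)
    (hφ0 : ∀ (σ : absoluteGaloisGroup ℚ), ∀ P ∈ Φ₀,
      σ • P = (φ ((modNCyclotomicCharacter ℚ m σ : (ZMod m)ˣ) : ZMod m)).val • P)
    (hψ0 : ∀ (σ : absoluteGaloisGroup ℚ) (Q : geomTorsion W (p : ℤ)),
      σ • Q - (ψ ((modNCyclotomicCharacter ℚ d σ : (ZMod d)ˣ) : ZMod d)).val • Q ∈ Φ₀) :
    delta W p v =
      (if φ (Rat.HeightOneSpectrum.natGenerator v : ZMod m) = (Rat.HeightOneSpectrum.natGenerator v : ZMod p)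
        then sFactor p (Rat.HeightOneSpectrum.natGenerator v) else 0) +
      (if ψ (Rat.HeightOneSpectrum.natGenerator v : ZMod d) = (Rat.HeightOneSpectrum.natGenerator v : ZMod p)
        then sFactor p (Rat.HeightOneSpectrum.natGenerator v) else 0) :=
  delta_eq_term_of_good hgood hpv (not_dvd_level_sub_of_good hgood hpv hΦ hφ hφ0)
    (not_dvd_level_quot_of_good hgood hpv hΦ hψ hφ0 hψ0) hΦ hφ0 hψ0

/-! ## §5. Good places cancel in the sub-row identity -/

/-- **Good places are idle in `S₀`.** For a rational `p`-line with PRIMITIVE presentations, a finite `S₀ ∌ (p)` and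
any `T ⊆ S₀` consisting of GOOD places: `n + Σ_{S₀} δ = Σ_{S₀} term ↔ n + Σ_{S₀ ∖ T} δ = Σ_{S₀ ∖ T} term` (the
`T`-parts of the two sums agree termwise by §4). So the datum's `S₀` may always be shrunk to the bad places, and padded
by good places. [cite: GreenbergVatsal2000, §2 Prop. (2.4) (p. 22) and §3 (28) p. 42] -/
theorem balance_iff_sdiff_of_good (hΦ : IsRationalLine W p Φ₀) (hφ : φ.IsPrimitive) (hψ : ψ.IsPrimitive)
    (hφ0 : ∀ (σ : absoluteGaloisGroup ℚ), ∀ P ∈ Φ₀,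
      σ • P = (φ ((modNCyclotomicCharacter ℚ m σ : (ZMod m)ˣ) : ZMod m)).val • P)
    (hψ0 : ∀ (σ : absoluteGaloisGroup ℚ) (Q : geomTorsion W (p : ℤ)),
      σ • Q - (ψ ((modNCyclotomicCharacter ℚ d σ : (ZMod d)ˣ) : ZMod d)).val • Q ∈ Φ₀)
    {S₀ T : Finset (HeightOneSpectrum (𝓞 ℚ))} (hTS : T ⊆ S₀)
    (hSp : ∀ v ∈ S₀, ((p : ℕ) : 𝓞 ℚ) ∉ v.asIdeal) (hT : ∀ v ∈ T, W.HasGoodReductionAt v) (n : ℕ) :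
    (n + ∑ v ∈ S₀, delta W p v =
      ∑ v ∈ S₀, ((if φ (Rat.HeightOneSpectrum.natGenerator v : ZMod m) =
            (Rat.HeightOneSpectrum.natGenerator v : ZMod p)
          then sFactor p (Rat.HeightOneSpectrum.natGenerator v) else 0) +
        (if ψ (Rat.HeightOneSpectrum.natGenerator v : ZMod d) =
            (Rat.HeightOneSpectrum.natGenerator v : ZMod p)
          then sFactor p (Rat.HeightOneSpectrum.natGenerator v) else 0))) ↔
    (n + ∑ v ∈ S₀ \ T, delta W p v =
      ∑ v ∈ S₀ \ T, ((if φ (Rat.HeightOneSpectrum.natGenerator v : ZMod m) =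
            (Rat.HeightOneSpectrum.natGenerator v : ZMod p)
          then sFactor p (Rat.HeightOneSpectrum.natGenerator v) else 0) +
        (if ψ (Rat.HeightOneSpectrum.natGenerator v : ZMod d) =
            (Rat.HeightOneSpectrum.natGenerator v : ZMod p)
          then sFactor p (Rat.HeightOneSpectrum.natGenerator v) else 0))) := by
  have hT' : ∑ v ∈ T, delta W p v =
      ∑ v ∈ T, ((if φ (Rat.HeightOneSpectrum.natGenerator v : ZMod m) =
            (Rat.HeightOneSpectrum.natGenerator v : ZMod p)
          then sFactor p (Rat.HeightOneSpectrum.natGenerator v) else 0) +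
        (if ψ (Rat.HeightOneSpectrum.natGenerator v : ZMod d) =
            (Rat.HeightOneSpectrum.natGenerator v : ZMod p)
          then sFactor p (Rat.HeightOneSpectrum.natGenerator v) else 0)) :=
    Finset.sum_congr rfl fun v hv ↦
      delta_eq_term_of_good_of_isPrimitive (hT v hv) (hSp v (hTS hv)) hΦ hφ hψ hφ0 hψ0
  rw [← Finset.sum_sdiff hTS, ← Finset.sum_sdiff hTS (f := fun v ↦ (if φ _ = _ then _ else 0) + _), hT']
  constructor
  · intro h; omega
  · intro h; omega

end Summit.BirchSwinnertonDyer.BirchSwinnertonDyer.Theorems.EisensteinPrimesLocalBalanceAtGoodPlace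

end
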